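import Literature.NumberTheory.Automorphic.GodementJacquetSingularMajorant
import Literature.NumberTheory.Automorphic.GLnSiegelHeightIntegrability
import Literature.NumberTheory.Automorphic.AutomorphicMeasureSiegelDomination
import Literature.NumberTheory.Automorphic.GodementJacquetReflection
import HarnessLib

/-!
# Integrability of the singular theta majorants against a Bruhat function and a cusp form

Topic `NumberTheory/Automorphic`; namespace `Literature.NumberTheory.Automorphic`. The absolute
convergence statement that licenses the term-wise treatment of the *singular* theta terms in the
Godement–Jacquet reflection formula (Godement–Jacquet (1972), §12), in the tree's formalism
(Bruhat functions on `G = GL_n(𝔸_K)`, `H = A_G GL_n(K)`), for ONE fixed group variable `x₀`: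

* `exists_siegel_lintegral_bruhat_mul_le` — for a Bruhat function `β` of `H`, Siegel data with
  `∫_G β U dν ≤ c ∫_{𝔖} U(g⁻¹) dν(g)` for every Borel right-`H`-invariant `U ≥ 0` (Weil's formula
  + `exists_lintegral_le_mul_setLIntegral_siegel`);
* `exists_isCompact_sndHom_inv_mem` — the finite parts `(g_f)⁻¹`, `g ∈ 𝔖`, lie in a compact set;
* `truncThetaMajorant Φ s x₀ α y = ∫_{A_G} |F₁^<(x₀ a y⁻¹)| Σ_ξ |Φ(x₀ ξ a y⁻¹)| dα` and
  `dualThetaMajorant` (**definitions**), Borel (`measurable_…`) and right `H`-invariant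
  (`…_mul_center`, `…_mul_arith`, `truncU_mul_quotientSubgroup`, `dualU_mul_quotientSubgroup`);
* **main**: `lintegral_bruhat_enorm_mul_truncThetaMajorant_lt_top` (`Re s > n + 1`) and
  `lintegral_bruhat_enorm_mul_dualThetaMajorant_lt_top` (`Re s > 2n + 1`):
  `∫_G β(y) |F([y])| K(x₀, y) dν(y) < ∞` for `F` with `invQuot F` continuous and rapidly decreasing
  (smoothed cusp forms), by `GodementJacquetSingularMajorant` on the Siegel set and
  `setLIntegral_siegel_enorm_mul_height_rpow_lt_top`.

## References

* R. Godement, H. Jacquet, *Zeta functions of simple algebras*, LNM 260 (1972), §12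
  [GodementJacquetLNM260].
* A. Borel, *Some finiteness properties of adele groups over number fields*, Publ. Math. IHÉS 16
  (1963), §5 [Borel1963].
-/

noncomputable section

open MeasureTheory Measure Set Filter Topology IsDedekindDomain NumberField
open Literature.MeasureTheory.Group
open scoped ENNReal NNReal Pointwise

namespace Literature.NumberTheory.Automorphic

variable {n : ℕ} {K : Type} [Field K] [NumberField K]

attribute [local instance] adelicBorel borelSpace_adelic locallyCompactSpace_adelic
  secondCountableTopology_gl_adelic measurableSpaceQuotient borelSpaceQuotient glBorel borelSpace_glBorel

attribute [local instance] smulInvariantMeasureQuotient isFiniteMeasureOnCompactsQuotient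

/-! ### Unfolding a Bruhat-weighted integral of an `H`-invariant function and Siegel domination -/

section Generic

variable (μ : Measure (AdelicGroupData.gl n K).automorphicQuotient) [(AdelicGroupData.gl n K).IsAutomorphicMeasure μ]
  (ν : Measure (AdelicGroupData.gl n K).Adelic) [ν.IsHaarMeasure]

include μ in
/-- **Bruhat-weighted integrals of `H`-invariant functions are dominated by Siegel-set integrals.**
For a Bruhat function `β` of `H = A_G GL_n(K)` there are `c < ∞` and Siegel data `(Ω, t, Z)` such that
for every Borel `U ≥ 0` on `G = GL_n(𝔸_K)` which is right `H`-invariant,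
`∫_G β U dν ≤ c ∫_{Z Ω A_t K} U(g⁻¹) dν(g)`: Weil's formula for `β · U` (whose fibre integrals are
the function `u` on `G/H` induced by `U`) and the domination of the automorphic measure by the
Siegel-set integral (`exists_lintegral_le_mul_setLIntegral_siegel`). [folklore] -/
theorem exists_siegel_lintegral_bruhat_mul_le {β : (AdelicGroupData.gl n K).Adelic → ℝ}
    (hβ : IsBruhatFunction (AdelicGroupData.gl n K).quotientSubgroup (quotientSubgroupHaar n K) β) :
    ∃ (c : ℝ≥0∞) (Ω : Set (GL (Fin n) (AdeleRing (𝓞 K) K))) (t : ℝ) (Z : Set (GL (Fin n) (AdeleRing (𝓞 K) K))),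
      c ≠ ⊤ ∧ 0 < t ∧ IsCompact Ω ∧ Ω ⊆ (standardParabolicGL (AdeleRing (𝓞 K) K) (id : Fin n → Fin n) : Set _) ∧
      IsCompact Z ∧ Z ⊆ Set.range (posRealScalar n K) ∧
      ∀ U : (AdelicGroupData.gl n K).Adelic → ℝ≥0∞, Measurable U →
        (∀ (y : (AdelicGroupData.gl n K).Adelic) (h : (AdelicGroupData.gl n K).quotientSubgroup),
          U (y * h) = U y) →
        ∫⁻ y, ENNReal.ofReal (β y) * U y ∂ν ≤
          c * ∫⁻ g in Z * (Ω * siegelCone n K t * (standardMaximalCompactGL n K : Set (GL (Fin n) (AdeleRing (𝓞 K) K)))),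
            U g⁻¹ ∂ν := by
  obtain ⟨cS, Ω, t, Z, hcS, ht, hΩc, hΩB, hZc, hZ, hle⟩ :=
    @exists_lintegral_le_mul_setLIntegral_siegel n K _ _ μ _ ν (by exact ‹ν.IsHaarMeasure›)
  have hcpos : 0 < unfoldingConstant (AdelicGroupData.gl n K).quotientSubgroup (quotientSubgroupHaar n K) μ ν :=
    automorphicUnfoldingConstant_pos n K μ ν
  refine ⟨((unfoldingConstant (AdelicGroupData.gl n K).quotientSubgroup (quotientSubgroupHaar n K) μ ν : ℝ≥0∞))⁻¹ * cS,
    Ω, t, Z, ENNReal.mul_ne_top (ENNReal.inv_ne_top.2 (ENNReal.coe_ne_zero.2 hcpos.ne')) hcS, ht, hΩc, hΩB, hZc, hZ,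
    fun U hUm hUinv => ?_⟩
  -- the induced function on the quotient
  set u : (AdelicGroupData.gl n K).automorphicQuotient → ℝ≥0∞ := fun x =>
    Quotient.liftOn' x U fun a b hab => by
      rw [QuotientGroup.leftRel_apply] at hab
      have h := hUinv a ⟨a⁻¹ * b, hab⟩
      rw [mul_inv_cancel_left] at h
      exact h.symm with hu
  have hu_mk : ∀ g : (AdelicGroupData.gl n K).Adelic, u (QuotientGroup.mk g) = U g := fun g => rfl
  -- Weil's formula for `β U`
  have hf : Measurable fun g : (AdelicGroupData.gl n K).Adelic =>
      ENNReal.ofReal (β g) * u (QuotientGroup.mk g) :=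
    hβ.continuous.measurable.ennreal_ofReal.mul hUm
  have hW := lintegral_fiberLIntegral_eq_mul_lintegral (AdelicGroupData.gl n K).quotientSubgroup
    (quotientSubgroupHaar n K) μ ν hf
  have hfib : ∀ x, fiberLIntegral (AdelicGroupData.gl n K).quotientSubgroup (quotientSubgroupHaar n K)
      (fun g => ENNReal.ofReal (β g) * u (QuotientGroup.mk g)) x = u x :=
    fun x => hβ.fiberLIntegral_ofReal_mul_comp_mk _ _ u x
  simp_rw [hfib] at hW
  -- `∫ β U dν = c_unf⁻¹ ∫_X u dμ ≤ c_unf⁻¹ c_S ∫_S u([g⁻¹]) dν`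
  have h1 : ∫⁻ y, ENNReal.ofReal (β y) * U y ∂ν =
      ((unfoldingConstant (AdelicGroupData.gl n K).quotientSubgroup (quotientSubgroupHaar n K) μ ν : ℝ≥0∞))⁻¹ *
        ∫⁻ x, u x ∂μ := by
    have hW' : ∫⁻ x, u x ∂μ =
        (unfoldingConstant (AdelicGroupData.gl n K).quotientSubgroup (quotientSubgroupHaar n K) μ ν : ℝ≥0∞) *
          ∫⁻ y, ENNReal.ofReal (β y) * U y ∂ν := hW
    rw [hW', ← mul_assoc, ENNReal.inv_mul_cancel (ENNReal.coe_ne_zero.2 hcpos.ne') ENNReal.coe_ne_top, one_mul]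
  rw [h1, mul_assoc]
  exact mul_le_mul_right (hle u) _

end Generic

/-! ### Finite parts on a Siegel set -/

/-- `diag(a) ∈ A_{T₀}` has trivial finite component (cf. `GLn.sndHom_posRealDiagonal` of the
Moeglin–Waldspurger rapid-decay file, restated to keep the imports light). [folklore] -/
theorem sndHom_posRealDiagonal' (a : Fin n → ℝ≥0ˣ) : GLn.sndHom n K (posRealDiagonal n K a) = 1 := by
  refine Matrix.GeneralLinearGroup.ext fun i j => ?_
  change (((posRealDiagonal n K a : GL (Fin n) (AdeleRing (𝓞 K) K)) : Matrix (Fin n) (Fin n) (AdeleRing (𝓞 K) K)) i j).2 =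
    (1 : Matrix (Fin n) (Fin n) (FiniteAdeleRing (𝓞 K) K)) i j
  rw [coe_posRealDiagonal, Matrix.diagonal_apply, Matrix.one_apply]
  split_ifs with h
  · exact posRealIdele_snd K (a i)
  · rfl

/-- **The finite parts of a Siegel set lie in a compact set**, and so do those of its inverses: for
`g = z ω a k ∈ Z Ω A_t K` (`z`, `a` archimedean), `(g_f)⁻¹ = (ω_f k_f)⁻¹`. [folklore] -/
theorem exists_isCompact_sndHom_inv_mem {Ω Z : Set (GL (Fin n) (AdeleRing (𝓞 K) K))} (hΩc : IsCompact Ω)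
    (hZ : Z ⊆ Set.range (posRealScalar n K)) (t : ℝ) :
    ∃ 𝒴 : Set (GL (Fin n) (FiniteAdeleRing (𝓞 K) K)), IsCompact 𝒴 ∧
      ∀ g ∈ Z * (Ω * siegelCone n K t * (standardMaximalCompactGL n K : Set (GL (Fin n) (AdeleRing (𝓞 K) K)))),
        GLn.sndHom n K g⁻¹ ∈ 𝒴 := by
  refine ⟨(fun p : GL (Fin n) (FiniteAdeleRing (𝓞 K) K) × GL (Fin n) (FiniteAdeleRing (𝓞 K) K) => (p.1 * p.2)⁻¹) ''
      ((GLn.sndHom n K '' Ω) ×ˢ (GLn.sndHom n K '' (standardMaximalCompactGL n K : Set (GL (Fin n) (AdeleRing (𝓞 K) K))))),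
    ((hΩc.image GLn.continuous_sndHom).prod
      ((isCompact_standardMaximalCompactGL (n := n) (K := K)).image GLn.continuous_sndHom)).image
      ((continuous_fst.mul continuous_snd).inv), ?_⟩
  rintro g ⟨z, hz, g₁, ⟨g₂, ⟨ω, hω, a, ha, rfl⟩, k, hk, rfl⟩, rfl⟩
  obtain ⟨r, rfl⟩ := hZ hz
  obtain ⟨b, -, -, rfl⟩ := ha
  refine ⟨(GLn.sndHom n K ω, GLn.sndHom n K k), ⟨⟨ω, hω, rfl⟩, ⟨k, hk, rfl⟩⟩, ?_⟩
  simp only [map_mul, map_inv, posRealScalar_eq_posRealDiagonal_const, sndHom_posRealDiagonal', one_mul, mul_one]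

/-! ### The majorants -/

section Majorants

variable (Φ : Matrix (Fin n) (Fin n) (AdeleRing (𝓞 K) K) → ℂ) (s : ℂ) (x₀ : (AdelicGroupData.gl n K).Adelic)
  (α : Measure (AdelicGroupData.gl n K).center')

/-- **The truncated-side singular majorant**
`K_T(x₀, y) = ∫_{A_G} |F₁^<(x₀ a y⁻¹)| Σ_{ξ ∈ M_n(K)} |Φ(x₀ ξ a y⁻¹)| dα(a)`. [folklore] -/
def truncThetaMajorant (y : (AdelicGroupData.gl n K).Adelic) : ℝ≥0∞ :=
  ∫⁻ a : (AdelicGroupData.gl n K).center',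
    (‖gjTruncF n K (fun _ => (1 : ℂ)) s (x₀ * (a : (AdelicGroupData.gl n K).Adelic) * y⁻¹)‖ₑ : ℝ≥0∞) *
      ∑' ξ : Matrix (Fin n) (Fin n) K,
        (‖Φ ((Units.val x₀ : Matrix (Fin n) (Fin n) (AdeleRing (𝓞 K) K)) * ratMatrix n K ξ *
          Units.val (((a : (AdelicGroupData.gl n K).Adelic) * y⁻¹ : (AdelicGroupData.gl n K).Adelic)))‖ₑ : ℝ≥0∞) ∂α

/-- **The dual-side singular majorant**
`K_D(x₀, y) = ∫_{A_G} |F''(y a x₀⁻¹)| Σ_{ξ ∈ M_n(K)} |Ψ(y a ξ x₀⁻¹)| dα(a)`. [folklore] -/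
def dualThetaMajorant (y : (AdelicGroupData.gl n K).Adelic) : ℝ≥0∞ :=
  ∫⁻ a : (AdelicGroupData.gl n K).center',
    (‖gjDualF n K (fun _ => (1 : ℂ)) ((n : ℂ) - s) (y * (a : (AdelicGroupData.gl n K).Adelic) * x₀⁻¹)‖ₑ : ℝ≥0∞) *
      ∑' ξ : Matrix (Fin n) (Fin n) K,
        (‖Φ (Units.val ((y * (a : (AdelicGroupData.gl n K).Adelic) : (AdelicGroupData.gl n K).Adelic)) *
          ratMatrix n K ξ * (Units.val (x₀⁻¹ : (AdelicGroupData.gl n K).Adelic)))‖ₑ : ℝ≥0∞) ∂α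

variable {Φ s x₀ α}

/-- `F₁^<` is Borel measurable. [folklore] -/
theorem measurable_gjTruncF_one (s : ℂ) :
    Measurable (gjTruncF n K (fun _ => (1 : ℂ)) s : (AdelicGroupData.gl n K).Adelic → ℂ) := by
  have hc : Continuous fun g : GL (Fin n) (AdeleRing (𝓞 K) K) => (1 : ℂ) * ((adelicAbsDet n K g : ℝ) : ℂ) ^ s :=
    continuous_const.mul (continuous_adelicAbsDet_cpow s)
  exact hc.measurable.indicator (measurableSet_detAtLeastOne (n := n) (K := K)).compl

/-- `F''_w` (with `Ψ = 1`) is Borel measurable. [folklore] -/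
theorem measurable_gjDualF_one (w : ℂ) :
    Measurable (gjDualF n K (fun _ => (1 : ℂ)) w : (AdelicGroupData.gl n K).Adelic → ℂ) := by
  have hc : Continuous fun g : GL (Fin n) (AdeleRing (𝓞 K) K) => (1 : ℂ) * ((adelicAbsDet n K g : ℝ) : ℂ) ^ w :=
    continuous_const.mul (continuous_adelicAbsDet_cpow w)
  exact hc.measurable.indicator (isOpen_detGtOne (n := n) (K := K)).measurableSet

/-- **`K_T(x₀, ·)` is Borel measurable** (`Φ` continuous, `α` s-finite). [folklore] -/
theorem measurable_truncThetaMajorant [SFinite α] (hΦ : Continuous Φ) :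
    Measurable (truncThetaMajorant Φ s x₀ α) := by
  haveI : Countable K := NumberField.countable' (K := K)
  haveI : Countable (Matrix (Fin n) (Fin n) K) := inferInstanceAs (Countable (Fin n → Fin n → K))
  unfold truncThetaMajorant
  have hm : Measurable fun p : (AdelicGroupData.gl n K).Adelic × (AdelicGroupData.gl n K).center' =>
      (‖gjTruncF n K (fun _ => (1 : ℂ)) s (x₀ * (p.2 : (AdelicGroupData.gl n K).Adelic) * p.1⁻¹)‖ₑ : ℝ≥0∞) *
        ∑' ξ : Matrix (Fin n) (Fin n) K,
          (‖Φ ((Units.val x₀ : Matrix (Fin n) (Fin n) (AdeleRing (𝓞 K) K)) * ratMatrix n K ξ *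
            Units.val (((p.2 : (AdelicGroupData.gl n K).Adelic) * p.1⁻¹ : (AdelicGroupData.gl n K).Adelic)))‖ₑ : ℝ≥0∞) := by
    refine Measurable.mul ?_ (Measurable.tsum fun ξ => ?_)
    · have hc : Continuous fun p : (AdelicGroupData.gl n K).Adelic × (AdelicGroupData.gl n K).center' =>
          x₀ * (p.2 : (AdelicGroupData.gl n K).Adelic) * p.1⁻¹ :=
        (continuous_const.mul (continuous_subtype_val.comp continuous_snd)).mul continuous_fst.inv
      exact ((measurable_gjTruncF_one s).comp hc.measurable).enorm
    · have hc : Continuous fun p : (AdelicGroupData.gl n K).Adelic × (AdelicGroupData.gl n K).center' =>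
          Φ ((Units.val x₀ : Matrix (Fin n) (Fin n) (AdeleRing (𝓞 K) K)) * ratMatrix n K ξ *
            Units.val (((p.2 : (AdelicGroupData.gl n K).Adelic) * p.1⁻¹ : (AdelicGroupData.gl n K).Adelic))) :=
        hΦ.comp ((continuous_const.mul continuous_const).mul
          (Units.continuous_val.comp ((continuous_subtype_val.comp continuous_snd).mul continuous_fst.inv)))
      exact hc.measurable.enorm
  exact hm.lintegral_prod_right'

/-- **`K_D(x₀, ·)` is Borel measurable.** [folklore] -/
theorem measurable_dualThetaMajorant [SFinite α] (hΦ : Continuous Φ) :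
    Measurable (dualThetaMajorant Φ s x₀ α) := by
  haveI : Countable K := NumberField.countable' (K := K)
  haveI : Countable (Matrix (Fin n) (Fin n) K) := inferInstanceAs (Countable (Fin n → Fin n → K))
  unfold dualThetaMajorant
  have hm : Measurable fun p : (AdelicGroupData.gl n K).Adelic × (AdelicGroupData.gl n K).center' =>
      (‖gjDualF n K (fun _ => (1 : ℂ)) ((n : ℂ) - s) (p.1 * (p.2 : (AdelicGroupData.gl n K).Adelic) * x₀⁻¹)‖ₑ : ℝ≥0∞) *
        ∑' ξ : Matrix (Fin n) (Fin n) K,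
          (‖Φ (Units.val ((p.1 * (p.2 : (AdelicGroupData.gl n K).Adelic) : (AdelicGroupData.gl n K).Adelic)) *
            ratMatrix n K ξ * (Units.val (x₀⁻¹ : (AdelicGroupData.gl n K).Adelic)))‖ₑ : ℝ≥0∞) := by
    refine Measurable.mul ?_ (Measurable.tsum fun ξ => ?_)
    · have hc : Continuous fun p : (AdelicGroupData.gl n K).Adelic × (AdelicGroupData.gl n K).center' =>
          p.1 * (p.2 : (AdelicGroupData.gl n K).Adelic) * x₀⁻¹ :=
        (continuous_fst.mul (continuous_subtype_val.comp continuous_snd)).mul continuous_const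
      exact ((measurable_gjDualF_one _).comp hc.measurable).enorm
    · have hc : Continuous fun p : (AdelicGroupData.gl n K).Adelic × (AdelicGroupData.gl n K).center' =>
          Φ (Units.val ((p.1 * (p.2 : (AdelicGroupData.gl n K).Adelic) : (AdelicGroupData.gl n K).Adelic)) *
            ratMatrix n K ξ * (Units.val (x₀⁻¹ : (AdelicGroupData.gl n K).Adelic))) :=
        hΦ.comp (((Units.continuous_val.comp (continuous_fst.mul (continuous_subtype_val.comp continuous_snd))).mul
          continuous_const).mul continuous_const)
      exact hc.measurable.enorm
  exact hm.lintegral_prod_right'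

/-! #### Invariance under `H = A_G GL_n(K)` on the right -/

/-- `|det (x a (y γ)⁻¹)|_𝔸 = |det (x a y⁻¹)|_𝔸` for `γ` in the arithmetic subgroup. [folklore] -/
theorem adelicAbsDet_mul_mul_inv_mul_arith {γ : GL (Fin n) (AdeleRing (𝓞 K) K)}
    (hγ : γ ∈ (AdelicGroupData.gl n K).arithmeticSubgroup) (x a y : GL (Fin n) (AdeleRing (𝓞 K) K)) :
    adelicAbsDet n K (x * a * (y * γ)⁻¹) = adelicAbsDet n K (x * a * y⁻¹) := by
  have h1 : adelicAbsDet n K γ⁻¹ = 1 := adelicAbsDet_eq_one_of_mem_arithmeticSubgroup (inv_mem hγ)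
  rw [_root_.mul_inv_rev, ← mul_assoc]
  simp only [map_mul, h1, mul_one]

/-- Right multiplication on `A_G` preserves its Haar measure (the elements of `A_G` commute). [folklore] -/
theorem lintegral_center_mul_right [α.IsMulLeftInvariant] (f : (AdelicGroupData.gl n K).center' → ℝ≥0∞)
    (a₀ : (AdelicGroupData.gl n K).center') : ∫⁻ a, f (a * a₀) ∂α = ∫⁻ a, f a ∂α := by
  have h : ∀ a : (AdelicGroupData.gl n K).center', a * a₀ = a₀ * a := fun a => by
    refine Subtype.ext (Units.ext ?_)
    change Units.val (a : (AdelicGroupData.gl n K).Adelic) * Units.val (a₀ : (AdelicGroupData.gl n K).Adelic) =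
      Units.val (a₀ : (AdelicGroupData.gl n K).Adelic) * Units.val (a : (AdelicGroupData.gl n K).Adelic)
    exact centerval_mul_comm a _
  simp_rw [h]
  exact lintegral_mul_left_eq_self _ a₀

/-- **`K_T(x₀, y a₀) = K_T(x₀, y)` for `a₀ ∈ A_G`** (substitute `a ↦ a a₀`). [folklore] -/
theorem truncThetaMajorant_mul_center [α.IsMulLeftInvariant] (y : (AdelicGroupData.gl n K).Adelic)
    (a₀ : (AdelicGroupData.gl n K).center') :
    truncThetaMajorant Φ s x₀ α (y * (a₀ : (AdelicGroupData.gl n K).Adelic)) = truncThetaMajorant Φ s x₀ α y := by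
  unfold truncThetaMajorant
  rw [← lintegral_center_mul_right (α := α) _ a₀]
  refine lintegral_congr fun a => ?_
  have h : ((a * a₀ : (AdelicGroupData.gl n K).center') : (AdelicGroupData.gl n K).Adelic) *
      (y * (a₀ : (AdelicGroupData.gl n K).Adelic))⁻¹ = (a : (AdelicGroupData.gl n K).Adelic) * y⁻¹ := by
    rw [Subgroup.coe_mul, _root_.mul_inv_rev, mul_assoc, mul_inv_cancel_left]
  rw [mul_assoc x₀, h, ← mul_assoc]

/-- **`K_D(x₀, y a₀) = K_D(x₀, y)` for `a₀ ∈ A_G`** (substitute `a ↦ a₀⁻¹ a`). [folklore] -/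
theorem dualThetaMajorant_mul_center [α.IsMulLeftInvariant] (y : (AdelicGroupData.gl n K).Adelic)
    (a₀ : (AdelicGroupData.gl n K).center') :
    dualThetaMajorant Φ s x₀ α (y * (a₀ : (AdelicGroupData.gl n K).Adelic)) = dualThetaMajorant Φ s x₀ α y := by
  unfold dualThetaMajorant
  conv_rhs => rw [← lintegral_mul_left_eq_self _ a₀]
  refine lintegral_congr fun a => ?_
  simp only [Subgroup.coe_mul, mul_assoc]

/-- **`K_T(x₀, y γ) = K_T(x₀, y)` for `γ ∈ GL_n(K)`**: `a (y γ)⁻¹ = γ⁻¹ a y⁻¹` (`a` central),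
`|det γ| = 1`, and the sum over `ξ ∈ M_n(K)` is reindexed by `ξ ↦ ξ γ⁻¹`. [folklore] -/
theorem truncThetaMajorant_mul_arith (y : (AdelicGroupData.gl n K).Adelic) {γ : (AdelicGroupData.gl n K).Adelic}
    (hγ : γ ∈ (AdelicGroupData.gl n K).arithmeticSubgroup) :
    truncThetaMajorant Φ s x₀ α (y * γ) = truncThetaMajorant Φ s x₀ α y := by
  obtain ⟨g, rfl⟩ := hγ
  have hmem : (AdelicGroupData.gl n K).toAdelic g ∈ (AdelicGroupData.gl n K).arithmeticSubgroup := ⟨g, rfl⟩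
  unfold truncThetaMajorant
  refine lintegral_congr fun a => ?_
  -- `a (y γ)⁻¹ = γ⁻¹ (a y⁻¹)`
  have hcomm : (a : (AdelicGroupData.gl n K).Adelic) * (y * (AdelicGroupData.gl n K).toAdelic g)⁻¹ =
      ((AdelicGroupData.gl n K).toAdelic g)⁻¹ * ((a : (AdelicGroupData.gl n K).Adelic) * y⁻¹) := by
    rw [_root_.mul_inv_rev, ← mul_assoc, ← mul_assoc]
    congr 1
    exact Units.ext (centerval_mul_comm a _)
  congr 1
  · -- the truncated factor depends on `|det|` only
    exact congrArg _ (gjTruncF_one_eq_of_adelicAbsDet_eq s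
      (adelicAbsDet_mul_mul_inv_mul_arith hmem x₀ (a : (AdelicGroupData.gl n K).Adelic) y))
  · -- reindex the lattice sum by `ξ ↦ ξ g⁻¹`
    have hval : Units.val ((a : (AdelicGroupData.gl n K).Adelic) * (y * (AdelicGroupData.gl n K).toAdelic g)⁻¹) =
        ratMatrix n K ((g⁻¹ : GL (Fin n) K) : Matrix (Fin n) (Fin n) K) *
          Units.val ((a : (AdelicGroupData.gl n K).Adelic) * y⁻¹) := by
      rw [hcomm, ← map_inv]
      rfl
    simp_rw [hval]
    refine (tsum_congr fun ξ => ?_).trans ((Units.mulRight (g⁻¹)).tsum_eq fun ξ : Matrix (Fin n) (Fin n) K =>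
      (‖Φ ((Units.val x₀ : Matrix (Fin n) (Fin n) (AdeleRing (𝓞 K) K)) * ratMatrix n K ξ *
        Units.val (((a : (AdelicGroupData.gl n K).Adelic) * y⁻¹ : (AdelicGroupData.gl n K).Adelic)))‖ₑ : ℝ≥0∞))
    simp only [Units.mulRight_apply, ratMatrix, Matrix.map_mul, Matrix.mul_assoc]

/-- **`K_D(x₀, y γ) = K_D(x₀, y)` for `γ ∈ GL_n(K)`**: `y γ a = y a γ`, `|det γ| = 1`, and the sum
is reindexed by `ξ ↦ γ ξ`. [folklore] -/
theorem dualThetaMajorant_mul_arith (y : (AdelicGroupData.gl n K).Adelic) {γ : (AdelicGroupData.gl n K).Adelic}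
    (hγ : γ ∈ (AdelicGroupData.gl n K).arithmeticSubgroup) :
    dualThetaMajorant Φ s x₀ α (y * γ) = dualThetaMajorant Φ s x₀ α y := by
  obtain ⟨g, rfl⟩ := hγ
  have hmem : (AdelicGroupData.gl n K).toAdelic g ∈ (AdelicGroupData.gl n K).arithmeticSubgroup := ⟨g, rfl⟩
  unfold dualThetaMajorant
  refine lintegral_congr fun a => ?_
  -- `(y γ) a = (y a) γ`
  have hcomm : y * (AdelicGroupData.gl n K).toAdelic g * (a : (AdelicGroupData.gl n K).Adelic) =
      y * (a : (AdelicGroupData.gl n K).Adelic) * (AdelicGroupData.gl n K).toAdelic g := by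
    rw [mul_assoc, mul_assoc]
    congr 1
    exact Units.ext (centerval_mul_comm a _).symm
  congr 1
  · exact congrArg _ (gjDualF_one_eq_of_adelicAbsDet_eq _
      (adelicAbsDet_mul_arith_mul_mul hmem y (a : (AdelicGroupData.gl n K).Adelic) x₀⁻¹))
  · have hval : Units.val (y * (AdelicGroupData.gl n K).toAdelic g * (a : (AdelicGroupData.gl n K).Adelic)) =
        Units.val (y * (a : (AdelicGroupData.gl n K).Adelic)) * ratMatrix n K (Units.val (α := Matrix (Fin n) (Fin n) K) g) := by
      rw [hcomm]
      rfl
    simp_rw [hval]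
    refine (tsum_congr fun ξ => ?_).trans ((Units.mulLeft (show GL (Fin n) K from g)).tsum_eq fun ξ : Matrix (Fin n) (Fin n) K =>
      (‖Φ (Units.val ((y * (a : (AdelicGroupData.gl n K).Adelic) : (AdelicGroupData.gl n K).Adelic)) *
          ratMatrix n K ξ * (Units.val (x₀⁻¹ : (AdelicGroupData.gl n K).Adelic)))‖ₑ : ℝ≥0∞))
    simp only [Units.mulLeft_apply, ratMatrix, Matrix.map_mul, Matrix.mul_assoc]

/-- Decomposition of an element of `H = A_G GL_n(K)` as `a γ`. [folklore] -/
theorem exists_eq_center_mul_arith (h : (AdelicGroupData.gl n K).quotientSubgroup) :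
    ∃ (a : (AdelicGroupData.gl n K).center') (γ : (AdelicGroupData.gl n K).Adelic),
      γ ∈ (AdelicGroupData.gl n K).arithmeticSubgroup ∧
        (h : (AdelicGroupData.gl n K).Adelic) = (a : (AdelicGroupData.gl n K).Adelic) * γ := by
  refine ⟨(quotientSubgroupEquiv n K h).1, (quotientSubgroupEquiv n K h).2, (quotientSubgroupEquiv n K h).2.2, ?_⟩
  have h1 := coe_quotientSubgroupEquiv_symm_apply (n := n) (K := K) (quotientSubgroupEquiv n K h)
  rw [ContinuousMulEquiv.symm_apply_apply] at h1
  exact h1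

/-- **`U_T(y) = |F([y])| K_T(x₀, y)` is right `H`-invariant.** [folklore] -/
theorem truncU_mul_quotientSubgroup [α.IsMulLeftInvariant] (F : (AdelicGroupData.gl n K).automorphicQuotient → ℂ)
    (y : (AdelicGroupData.gl n K).Adelic) (h : (AdelicGroupData.gl n K).quotientSubgroup) :
    (‖F (QuotientGroup.mk (y * h))‖ₑ : ℝ≥0∞) * truncThetaMajorant Φ s x₀ α (y * h) =
      (‖F (QuotientGroup.mk y)‖ₑ : ℝ≥0∞) * truncThetaMajorant Φ s x₀ α y := by
  obtain ⟨a, γ, hγ, hh⟩ := exists_eq_center_mul_arith h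
  rw [QuotientGroup.mk_mul_of_mem y h.2, hh, ← mul_assoc, truncThetaMajorant_mul_arith _ hγ,
    truncThetaMajorant_mul_center]

/-- **`U_D(y) = |F([y])| K_D(x₀, y)` is right `H`-invariant.** [folklore] -/
theorem dualU_mul_quotientSubgroup [α.IsMulLeftInvariant] (F : (AdelicGroupData.gl n K).automorphicQuotient → ℂ)
    (y : (AdelicGroupData.gl n K).Adelic) (h : (AdelicGroupData.gl n K).quotientSubgroup) :
    (‖F (QuotientGroup.mk (y * h))‖ₑ : ℝ≥0∞) * dualThetaMajorant Φ s x₀ α (y * h) =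
      (‖F (QuotientGroup.mk y)‖ₑ : ℝ≥0∞) * dualThetaMajorant Φ s x₀ α y := by
  obtain ⟨a, γ, hγ, hh⟩ := exists_eq_center_mul_arith h
  rw [QuotientGroup.mk_mul_of_mem y h.2, hh, ← mul_assoc, dualThetaMajorant_mul_arith _ hγ,
    dualThetaMajorant_mul_center]

end Majorants

/-! ### The main integrability statements -/

section Main

variable (μ : Measure (AdelicGroupData.gl n K).automorphicQuotient) [(AdelicGroupData.gl n K).IsAutomorphicMeasure μ]
  (ν : Measure (AdelicGroupData.gl n K).Adelic) [ν.IsHaarMeasure]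

/-- `y ↦ F([y])` is continuous when `invQuot F` is. [folklore] -/
theorem continuous_comp_mk_of_continuous_invQuot {F : (AdelicGroupData.gl n K).automorphicQuotient → ℂ}
    (hFc : Continuous (invQuot (AdelicGroupData.gl n K) F)) :
    Continuous fun y : (AdelicGroupData.gl n K).Adelic => F (QuotientGroup.mk y) := by
  have h := hFc.comp continuous_inv
  refine h.congr fun y => ?_
  simp only [Function.comp_apply, invQuot_apply, inv_inv]
  rfl

include μ in
/-- **Integrability of the truncated-side singular majorant against a Bruhat function and a rapidly
decreasing form**: for `Φ ∈ 𝒮(M_n(𝔸_K))`, `Re s > n + 1`, `β` a Bruhat function of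
`H = A_G GL_n(K)` and `F` on `GL_n(K) A_G \ GL_n(𝔸_K)` with `invQuot F` continuous and rapidly
decreasing on Siegel sets,
`∫_G β(y) |F([y])| K_T(x₀, y) dν(y) < ∞`.
Proof: `U = |F ∘ π| K_T(x₀, ·)` is Borel and right `H`-invariant, so
`∫ β U dν ≤ c ∫_{𝔖} U(g⁻¹) dν(g)` (`exists_siegel_lintegral_bruhat_mul_le`); on the Siegel set
`K_T(x₀, g⁻¹) ≤ C (1 ⊔ ‖g‖)^{2θ}` (`exists_lintegral_center_truncTheta_le`, the finite parts
`(g_f)⁻¹` lying in a fixed compact set), and `∫_{𝔖} |F(g⁻¹ ·)| (1 ⊔ ‖g‖)^{2θ} dν < ∞` by rapid decay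
(`setLIntegral_siegel_enorm_mul_height_rpow_lt_top`). This is the absolute convergence behind the
term-wise integration of the singular theta terms, Godement–Jacquet (1972), §12, for one fixed
variable `x₀`. [cite: GodementJacquetLNM260, §12] -/
theorem lintegral_bruhat_enorm_mul_truncThetaMajorant_lt_top (hn : 0 < n)
    {Φ : Matrix (Fin n) (Fin n) (AdeleRing (𝓞 K) K) → ℂ} (hΦ : Φ ∈ schwartzBruhatAdelicMatrix n K)
    (x₀ : (AdelicGroupData.gl n K).Adelic) {s : ℂ} (hs : (n : ℝ) + 1 < s.re)
    {α : Measure (AdelicGroupData.gl n K).center'} [α.IsHaarMeasure] {c : ℝ≥0}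
    (hα : α.map (centerLog n K hn) = c • (volume : Measure ℝ))
    {β : (AdelicGroupData.gl n K).Adelic → ℝ}
    (hβ : IsBruhatFunction (AdelicGroupData.gl n K).quotientSubgroup (quotientSubgroupHaar n K) β)
    {F : (AdelicGroupData.gl n K).automorphicQuotient → ℂ}
    (hFc : Continuous (invQuot (AdelicGroupData.gl n K) F))
    (hFd : IsRapidlyDecreasingGL n K (invQuot (AdelicGroupData.gl n K) F)) :
    ∫⁻ y, ENNReal.ofReal (β y) * ((‖F (QuotientGroup.mk y)‖ₑ : ℝ≥0∞) * truncThetaMajorant Φ s x₀ α y) ∂ν < ⊤ := by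
  haveI : NeZero n := ⟨hn.ne'⟩
  obtain ⟨cS, Ω, t, Z, hcS, ht, hΩc, hΩB, hZc, hZ, hle⟩ := exists_siegel_lintegral_bruhat_mul_le μ ν hβ
  obtain ⟨𝒴, h𝒴c, h𝒴⟩ := exists_isCompact_sndHom_inv_mem (n := n) (K := K) hΩc hZ t
  obtain ⟨C, hC, hbound⟩ := exists_lintegral_center_truncTheta_le hn hΦ x₀ hs h𝒴c hα
  have hFmk := continuous_comp_mk_of_continuous_invQuot hFc
  have hUm : Measurable fun y : (AdelicGroupData.gl n K).Adelic =>
      (‖F (QuotientGroup.mk y)‖ₑ : ℝ≥0∞) * truncThetaMajorant Φ s x₀ α y :=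
    hFmk.measurable.enorm.mul (measurable_truncThetaMajorant (continuous_of_mem_schwartzBruhatAdelicMatrix' hΦ))
  have hmain := hle _ hUm (fun y h => truncU_mul_quotientSubgroup F y h)
  refine lt_of_le_of_lt hmain (ENNReal.mul_lt_top hcS.lt_top ?_)
  -- on the Siegel set
  set θ2 : ℝ := 2 * (((n * n : ℕ) : ℝ) * Module.finrank ℚ K + 1) with hθ2
  have hθ2pos : 0 ≤ θ2 := by positivity
  have hSm : MeasurableSet (Z * (Ω * siegelCone n K t *
      (standardMaximalCompactGL n K : Set (GL (Fin n) (AdeleRing (𝓞 K) K))))) :=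
    measurableSet_mul_siegelSet n K hZc hΩc ht
  have hfin := @setLIntegral_siegel_enorm_mul_height_rpow_lt_top n K _ _ hn _ _ ν (by exact ‹ν.IsHaarMeasure›)
    _ hFc hFd _ hθ2pos _ hΩc hΩB _ ht _ hZc hZ
  -- pointwise on the Siegel set: `U(g⁻¹) ≤ C |F(g⁻¹ ·)| (1 ⊔ ‖g‖)^{θ2}`
  have hpt : ∀ g ∈ Z * (Ω * siegelCone n K t * (standardMaximalCompactGL n K : Set (GL (Fin n) (AdeleRing (𝓞 K) K)))),
      (‖F (QuotientGroup.mk g⁻¹)‖ₑ : ℝ≥0∞) * truncThetaMajorant Φ s x₀ α g⁻¹ ≤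
        C * ((‖invQuot (AdelicGroupData.gl n K) F g‖ₑ : ℝ≥0∞) * ENNReal.ofReal ((1 ⊔ adelicHeightGL n K g) ^ θ2)) := by
    intro g hg
    have hK : truncThetaMajorant Φ s x₀ α g⁻¹ ≤ C * ENNReal.ofReal ((1 ⊔ adelicHeightGL n K g) ^ θ2) := by
      have h := hbound (g⁻¹ : GL (Fin n) (AdeleRing (𝓞 K) K)) (h𝒴 g hg)
      rw [adelicHeightGL_inv] at h
      exact h
    calc (‖F (QuotientGroup.mk g⁻¹)‖ₑ : ℝ≥0∞) * truncThetaMajorant Φ s x₀ α g⁻¹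
        ≤ (‖F (QuotientGroup.mk g⁻¹)‖ₑ : ℝ≥0∞) * (C * ENNReal.ofReal ((1 ⊔ adelicHeightGL n K g) ^ θ2)) :=
          mul_le_mul_right hK _
      _ = C * ((‖invQuot (AdelicGroupData.gl n K) F g‖ₑ : ℝ≥0∞) * ENNReal.ofReal ((1 ⊔ adelicHeightGL n K g) ^ θ2)) := by
          rw [invQuot_apply, mul_left_comm]
          rfl
  calc ∫⁻ g in Z * (Ω * siegelCone n K t * (standardMaximalCompactGL n K : Set (GL (Fin n) (AdeleRing (𝓞 K) K)))),
        (‖F (QuotientGroup.mk g⁻¹)‖ₑ : ℝ≥0∞) * truncThetaMajorant Φ s x₀ α g⁻¹ ∂ν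
      ≤ ∫⁻ g in Z * (Ω * siegelCone n K t * (standardMaximalCompactGL n K : Set (GL (Fin n) (AdeleRing (𝓞 K) K)))),
          C * ((‖invQuot (AdelicGroupData.gl n K) F g‖ₑ : ℝ≥0∞) * ENNReal.ofReal ((1 ⊔ adelicHeightGL n K g) ^ θ2)) ∂ν :=
        setLIntegral_mono' hSm hpt
    _ = C * ∫⁻ g in Z * (Ω * siegelCone n K t * (standardMaximalCompactGL n K : Set (GL (Fin n) (AdeleRing (𝓞 K) K)))),
          (‖invQuot (AdelicGroupData.gl n K) F g‖ₑ : ℝ≥0∞) * ENNReal.ofReal ((1 ⊔ adelicHeightGL n K g) ^ θ2) ∂ν :=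
        lintegral_const_mul' _ _ hC
    _ < ⊤ := ENNReal.mul_lt_top hC.lt_top hfin


include μ in
/-- **Integrability of the dual-side singular majorant against a Bruhat function and a rapidly
decreasing form**: for `Φ ∈ 𝒮(M_n(𝔸_K))`, `Re s > 2n + 1`, `β` a Bruhat function of
`H = A_G GL_n(K)` and `F` on `GL_n(K) A_G \ GL_n(𝔸_K)` with `invQuot F` continuous and rapidly
decreasing on Siegel sets,
`∫_G β(y) |F([y])| K_D(x₀, y) dν(y) < ∞`.
Proof: `U = |F ∘ π| K_D(x₀, ·)` is Borel and right `H`-invariant, so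
`∫ β U dν ≤ c ∫_{𝔖} U(g⁻¹) dν(g)` (`exists_siegel_lintegral_bruhat_mul_le`); on the Siegel set
`K_D(x₀, g⁻¹) ≤ C (1 ⊔ ‖g‖)^{2θ}` (`exists_lintegral_center_dualTheta_le`, the finite parts
`(g_f)⁻¹` lying in a fixed compact set), and `∫_{𝔖} |F(g⁻¹ ·)| (1 ⊔ ‖g‖)^{2θ} dν < ∞` by rapid decay
(`setLIntegral_siegel_enorm_mul_height_rpow_lt_top`). This is the absolute convergence behind the
term-wise integration of the singular theta terms, Godement–Jacquet (1972), §12, for one fixed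
variable `x₀`. [cite: GodementJacquetLNM260, §12] -/
theorem lintegral_bruhat_enorm_mul_dualThetaMajorant_lt_top (hn : 0 < n)
    {Φ : Matrix (Fin n) (Fin n) (AdeleRing (𝓞 K) K) → ℂ} (hΦ : Φ ∈ schwartzBruhatAdelicMatrix n K)
    (x₀ : (AdelicGroupData.gl n K).Adelic) {s : ℂ} (hs : 2 * (n : ℝ) + 1 < s.re)
    {α : Measure (AdelicGroupData.gl n K).center'} [α.IsHaarMeasure] {c : ℝ≥0}
    (hα : α.map (centerLog n K hn) = c • (volume : Measure ℝ))
    {β : (AdelicGroupData.gl n K).Adelic → ℝ}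
    (hβ : IsBruhatFunction (AdelicGroupData.gl n K).quotientSubgroup (quotientSubgroupHaar n K) β)
    {F : (AdelicGroupData.gl n K).automorphicQuotient → ℂ}
    (hFc : Continuous (invQuot (AdelicGroupData.gl n K) F))
    (hFd : IsRapidlyDecreasingGL n K (invQuot (AdelicGroupData.gl n K) F)) :
    ∫⁻ y, ENNReal.ofReal (β y) * ((‖F (QuotientGroup.mk y)‖ₑ : ℝ≥0∞) * dualThetaMajorant Φ s x₀ α y) ∂ν < ⊤ := by
  haveI : NeZero n := ⟨hn.ne'⟩
  obtain ⟨cS, Ω, t, Z, hcS, ht, hΩc, hΩB, hZc, hZ, hle⟩ := exists_siegel_lintegral_bruhat_mul_le μ ν hβ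
  obtain ⟨𝒴, h𝒴c, h𝒴⟩ := exists_isCompact_sndHom_inv_mem (n := n) (K := K) hΩc hZ t
  obtain ⟨C, hC, hbound⟩ := exists_lintegral_center_dualTheta_le hn hΦ x₀ hs h𝒴c hα
  have hFmk := continuous_comp_mk_of_continuous_invQuot hFc
  have hUm : Measurable fun y : (AdelicGroupData.gl n K).Adelic =>
      (‖F (QuotientGroup.mk y)‖ₑ : ℝ≥0∞) * dualThetaMajorant Φ s x₀ α y :=
    hFmk.measurable.enorm.mul (measurable_dualThetaMajorant (continuous_of_mem_schwartzBruhatAdelicMatrix' hΦ))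
  have hmain := hle _ hUm (fun y h => dualU_mul_quotientSubgroup F y h)
  refine lt_of_le_of_lt hmain (ENNReal.mul_lt_top hcS.lt_top ?_)
  -- on the Siegel set
  set θ2 : ℝ := 2 * (((n * n : ℕ) : ℝ) * Module.finrank ℚ K + 1) with hθ2
  have hθ2pos : 0 ≤ θ2 := by positivity
  have hSm : MeasurableSet (Z * (Ω * siegelCone n K t *
      (standardMaximalCompactGL n K : Set (GL (Fin n) (AdeleRing (𝓞 K) K))))) :=
    measurableSet_mul_siegelSet n K hZc hΩc ht
  have hfin := @setLIntegral_siegel_enorm_mul_height_rpow_lt_top n K _ _ hn _ _ ν (by exact ‹ν.IsHaarMeasure›)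
    _ hFc hFd _ hθ2pos _ hΩc hΩB _ ht _ hZc hZ
  -- pointwise on the Siegel set: `U(g⁻¹) ≤ C |F(g⁻¹ ·)| (1 ⊔ ‖g‖)^{θ2}`
  have hpt : ∀ g ∈ Z * (Ω * siegelCone n K t * (standardMaximalCompactGL n K : Set (GL (Fin n) (AdeleRing (𝓞 K) K)))),
      (‖F (QuotientGroup.mk g⁻¹)‖ₑ : ℝ≥0∞) * dualThetaMajorant Φ s x₀ α g⁻¹ ≤
        C * ((‖invQuot (AdelicGroupData.gl n K) F g‖ₑ : ℝ≥0∞) * ENNReal.ofReal ((1 ⊔ adelicHeightGL n K g) ^ θ2)) := by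
    intro g hg
    have hK : dualThetaMajorant Φ s x₀ α g⁻¹ ≤ C * ENNReal.ofReal ((1 ⊔ adelicHeightGL n K g) ^ θ2) := by
      have h := hbound (g⁻¹ : GL (Fin n) (AdeleRing (𝓞 K) K)) (h𝒴 g hg)
      rw [adelicHeightGL_inv] at h
      exact h
    calc (‖F (QuotientGroup.mk g⁻¹)‖ₑ : ℝ≥0∞) * dualThetaMajorant Φ s x₀ α g⁻¹
        ≤ (‖F (QuotientGroup.mk g⁻¹)‖ₑ : ℝ≥0∞) * (C * ENNReal.ofReal ((1 ⊔ adelicHeightGL n K g) ^ θ2)) :=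
          mul_le_mul_right hK _
      _ = C * ((‖invQuot (AdelicGroupData.gl n K) F g‖ₑ : ℝ≥0∞) * ENNReal.ofReal ((1 ⊔ adelicHeightGL n K g) ^ θ2)) := by
          rw [invQuot_apply, mul_left_comm]
          rfl
  calc ∫⁻ g in Z * (Ω * siegelCone n K t * (standardMaximalCompactGL n K : Set (GL (Fin n) (AdeleRing (𝓞 K) K)))),
        (‖F (QuotientGroup.mk g⁻¹)‖ₑ : ℝ≥0∞) * dualThetaMajorant Φ s x₀ α g⁻¹ ∂ν
      ≤ ∫⁻ g in Z * (Ω * siegelCone n K t * (standardMaximalCompactGL n K : Set (GL (Fin n) (AdeleRing (𝓞 K) K)))),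
          C * ((‖invQuot (AdelicGroupData.gl n K) F g‖ₑ : ℝ≥0∞) * ENNReal.ofReal ((1 ⊔ adelicHeightGL n K g) ^ θ2)) ∂ν :=
        setLIntegral_mono' hSm hpt
    _ = C * ∫⁻ g in Z * (Ω * siegelCone n K t * (standardMaximalCompactGL n K : Set (GL (Fin n) (AdeleRing (𝓞 K) K)))),
          (‖invQuot (AdelicGroupData.gl n K) F g‖ₑ : ℝ≥0∞) * ENNReal.ofReal ((1 ⊔ adelicHeightGL n K g) ^ θ2) ∂ν :=
        lintegral_const_mul' _ _ hC
    _ < ⊤ := ENNReal.mul_lt_top hC.lt_top hfin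

end Main



end Literature.NumberTheory.Automorphic
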